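import Summits.AnomalousDissipation.AnomalousDissipation.Theorems.SolenoidalFractalHomogenisationLagrangianStepW7ThreeModeForm
import Literature.Analysis.FluidPDE.PassiveVectorTensorUniqueness
import HarnessLib

/-!
# K1L_D (stmt-AnomalousDissipation-27980), registry v8 — W7 ENGINE, THREE-MODE FORM INEQUALITY: FIBRE INSTANTIATION on `ℂ³` (§F, §F5)

Theorems-side landing of §F/§F5 of planner ad-ideate-p4 g13's kernel-checked crux workfile `Cruxes/LagrangianRenormalisationStep/Lines/onelevel_W7_threemode_vector.lean`
v3 (crux write commit 5e650f09fd83, 0 sorry), VERBATIM (`C3` spelled out as `EuclideanSpace ℂ (Fin 3)`): `inner_transversalProj_comm`, `transversalProj_idem`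
(the Leray projection `Torus.transversalProj K` is a ℂ-self-adjoint idempotent), `re_inner_modalAdjGen_ge` (coercivity `4π²·lo·|K|²‖w‖² ≤ Re⟪modalAdjGen 𝔸 K w, w⟫`
for `kdot K w = 0` under `NearIso 𝔸 lo hi` — the `d_j` of the window), **`threeModeC3_form_le`** / `threeModeC3_equiv` / `rampC3_pairing_le` (the abstract
theorems of `…W7ThreeModeForm` instantiated through `InnerProductSpace.rclikeToReal ℂ` inside the proofs), `coercivity_modalAdjGen`, and §F5
**`norm_modalAdjGen_le`**: `kdot K w = 0 → ‖modalAdjGen 𝔸 K w‖ ≤ 4π²(hi + β/2)|K|²‖w‖` under `NearIso 𝔸 lo hi` (`0 ≤ lo`, `0 ≤ hi`), `OddSmall 𝔸 β`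
(`0 ≤ β`) — so ALL window hypotheses (`d_j`, `Dmax`, `D0`) of the engine are discharged from the `ClassDecayW` window.  What remains for the W7 assembly
(S1): identify the Leray-projected Bloch-fibre chain ODE of `cellField cubatureWord …` with `dW0C/dWpC/dWmC` during each slot.
Landed by the W7 assembly owner (prover ad-sawtooth-k1loc-p1 g11, tenure GO 21:32:19Z); mathematics: p4 g13 (lens «control»).
NOT a proof of the crux / of AD; rung F-D1.A0. [cite: BedrossianCotiZelati2017, §2] [problem: turb]
-/

set_option linter.dupNamespace false

namespace Summit.AnomalousDissipation.AnomalousDissipation.Theorems.SolenoidalFractalHomogenisation.LagrangianStep.ThreeMode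

open scoped InnerProductSpace

section Fibre

open Literature.Analysis.FluidPDE Literature.Analysis.FluidPDE.Torus

/-! ## §1 The Leray projection at a wave vector is a self-adjoint idempotent -/

/-- `inner_transversalProj_comm` (p4 g13, W7 three-mode fibre layer; see the module docstring). -/
theorem inner_transversalProj_comm (K : Fin 3 → ℤ) (x z : (EuclideanSpace ℂ (Fin 3))) :
    ⟪transversalProj K x, z⟫_ℂ = ⟪x, transversalProj K z⟫_ℂ := by
  have hxK : ⟪x, waveVecC K⟫_ℂ = (starRingEnd ℂ) (kdot K x) := by
    rw [← inner_conj_symm, inner_waveVecC_left]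
  have hKz : ⟪waveVecC K, z⟫_ℂ = kdot K z := inner_waveVecC_left K z
  have hr : (starRingEnd ℂ) ((Literature.Analysis.FunctionSpaces.Torus.freqNormSq K : ℂ)⁻¹) =
      ((Literature.Analysis.FunctionSpaces.Torus.freqNormSq K : ℂ)⁻¹) := by
    rw [map_inv₀, Complex.conj_ofReal]
  rw [transversalProj_apply, transversalProj_apply, inner_sub_left, inner_sub_right, inner_smul_left,
    inner_smul_right, hxK, hKz, map_mul, hr]
  ring

/-- `|0|² = 0` for the lattice frequency norm on `ℤ³`. -/
theorem freqNormSq_zero3 : Literature.Analysis.FunctionSpaces.Torus.freqNormSq (0 : Fin 3 → ℤ) = 0 := by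
  simp [Literature.Analysis.FunctionSpaces.Torus.freqNormSq]

/-- The Leray projection at a wave vector is idempotent. -/
theorem transversalProj_idem (K : Fin 3 → ℤ) (x : (EuclideanSpace ℂ (Fin 3))) :
    transversalProj K (transversalProj K x) = transversalProj K x := by
  by_cases hK : K = 0
  · subst hK
    simp [transversalProj_apply]
  · exact transversalProj_eq_self_of_kdot_eq_zero K (kdot_transversalProj hK x)

/-- The Leray projection fixes transversal vectors. -/
theorem transversalProj_eq_self_of_kdot (K : Fin 3 → ℤ) {v : (EuclideanSpace ℂ (Fin 3))} (hv : kdot K v = 0) :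
    transversalProj K v = v :=
  transversalProj_eq_self_of_kdot_eq_zero K hv

/-! ## §2 Coercivity of the tree's modal generator on transversal vectors -/

/-- `4π²·lo·|K|²·‖w‖² ≤ Re⟪L_K w, w⟫` for transversal `w` under `NearIso 𝔸 lo hi`, `L_K = modalAdjGen 𝔸 K`. -/
theorem re_inner_modalAdjGen_ge {𝔸 : Visc4 (Fin 3)} {lo hi : ℝ} (h𝔸 : NearIso 𝔸 lo hi) (K : Fin 3 → ℤ)
    {w : (EuclideanSpace ℂ (Fin 3))} (hw : kdot K w = 0) :
    4 * Real.pi ^ 2 * lo * (Literature.Analysis.FunctionSpaces.Torus.freqNormSq K * ‖w‖ ^ 2)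
      ≤ (⟪modalAdjGen 𝔸 K w, w⟫_ℂ).re := by
  have hsym : (⟪modalAdjGen 𝔸 K w, w⟫_ℂ).re = (⟪w, modalAdjGen 𝔸 K w⟫_ℂ).re := by
    rw [← inner_conj_symm, Complex.conj_re]
  have hz : ∑ j, (K j : ℂ) * w j = 0 := by rw [← kdot_apply]; exact hw
  have h1 := lo_mul_le_re_inner_symbT h𝔸 (k := K) (z := w) hz
  rw [hsym, re_inner_modalAdjGen_self 𝔸 K hw]
  have hpi : 0 ≤ 4 * Real.pi ^ 2 := by positivity
  nlinarith [mul_le_mul_of_nonneg_left h1 hpi]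

/-- Transversality of the modal generator's output (by name). -/
theorem kdot_modalAdjGen_eq_zero (𝔸 : Visc4 (Fin 3)) {K : Fin 3 → ℤ} (hK : K ≠ 0) (w : (EuclideanSpace ℂ (Fin 3))) :
    kdot K (modalAdjGen 𝔸 K w) = 0 :=
  kdot_modalAdjGen 𝔸 hK w

/-! ## §4 The form inequality, the equivalence and the ramp pairing on the fibre -/

/-- **Three-mode form inequality on the Bloch fibre `ℂ³`** (instantiation of `threeModeV_form_le` with the Leray projections
`P_j = transversalProj K_j`; transversality as `kdot`-conditions; coercivity / norm bounds / window constants as in the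
abstract layer). -/
theorem threeModeC3_form_le (l e d0 dp dm dpp dmm dmin dtwo Dmax D0 : ℝ) (K0 Kp Km : Fin 3 → ℤ)
    (w0 wp wm wpp wmm y0 yp ym ypp ymm : (EuclideanSpace ℂ (Fin 3)))
    (hw0 : kdot K0 w0 = 0) (hyp : kdot Kp yp = 0) (hym : kdot Km ym = 0)
    (hl : 0 ≤ l) (he : 0 ≤ e) (hd0 : 0 ≤ d0) (hdmin : 0 ≤ dmin) (hD0 : 0 ≤ D0)
    (hg0 : d0 * ‖w0‖ ^ 2 ≤ (⟪y0, w0⟫_ℂ).re) (hgp : dp * ‖wp‖ ^ 2 ≤ (⟪yp, wp⟫_ℂ).re)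
    (hgm : dm * ‖wm‖ ^ 2 ≤ (⟪ym, wm⟫_ℂ).re) (hgpp : dpp * ‖wpp‖ ^ 2 ≤ (⟪ypp, wpp⟫_ℂ).re)
    (hgmm : dmm * ‖wmm‖ ^ 2 ≤ (⟪ymm, wmm⟫_ℂ).re)
    (hYp : ‖yp‖ ≤ Dmax * ‖wp‖) (hYm : ‖ym‖ ≤ Dmax * ‖wm‖) (hY0 : ‖y0‖ ≤ D0 * ‖w0‖)
    (hp : dmin ≤ dp) (hm : dmin ≤ dm) (hpp : dtwo ≤ dpp) (hmm : dtwo ≤ dmm)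
    (c1 : 8 * e * l ^ 2 ≤ dmin) (c2 : 4 * e * Dmax ^ 2 ≤ dmin) (c3 : e * l ^ 2 ≤ dtwo)
    (c4 : 32 * e ^ 2 * l ^ 2 * D0 ^ 2 ≤ d0 * dmin) :
    -2 * ((⟪y0, w0⟫_ℂ).re + (⟪yp, wp⟫_ℂ).re + (⟪ym, wm⟫_ℂ).re + (⟪ypp, wpp⟫_ℂ).re + (⟪ymm, wmm⟫_ℂ).re)
        + e * xdotC l K0 Kp Km w0 wp wm wpp wmm y0 yp ym
      ≤ -(e * l ^ 2 / 2) * (‖transversalProj Kp w0‖ ^ 2 + ‖transversalProj Km w0‖ ^ 2)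
        - (5 * dmin / 4) * (‖wp‖ ^ 2 + ‖wm‖ ^ 2) - dtwo * (‖wpp‖ ^ 2 + ‖wmm‖ ^ 2) - (7 * d0 / 4) * ‖w0‖ ^ 2 := by
  letI ipr : InnerProductSpace ℝ (EuclideanSpace ℂ (Fin 3)) := InnerProductSpace.rclikeToReal ℂ (EuclideanSpace ℂ (Fin 3))
  have hri : ∀ x z : (EuclideanSpace ℂ (Fin 3)), ⟪x, z⟫_ℝ = (⟪x, z⟫_ℂ).re := fun x z => real_inner_eq_re_inner ℂ x z
  have hsa : ∀ (K : Fin 3 → ℤ) (x z : (EuclideanSpace ℂ (Fin 3))),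
      ⟪(fun v => transversalProj K v) x, z⟫_ℝ = ⟪x, (fun v => transversalProj K v) z⟫_ℝ := by
    intro K x z; simp only [hri, inner_transversalProj_comm]
  have hid : ∀ (K : Fin 3 → ℤ) (x : (EuclideanSpace ℂ (Fin 3))),
      (fun v => transversalProj K v) ((fun v => transversalProj K v) x) = (fun v => transversalProj K v) x :=
    fun K x => transversalProj_idem K x
  have hw0' : (fun v => transversalProj K0 v) w0 = w0 := transversalProj_eq_self_of_kdot K0 hw0
  have hyp' : (fun v => transversalProj Kp v) yp = yp := transversalProj_eq_self_of_kdot Kp hyp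
  have hym' : (fun v => transversalProj Km v) ym = ym := transversalProj_eq_self_of_kdot Km hym
  have h := threeModeV_form_le (E := (EuclideanSpace ℂ (Fin 3))) l e d0 dp dm dpp dmm dmin dtwo Dmax D0
    (fun v => transversalProj K0 v) (fun v => transversalProj Kp v) (fun v => transversalProj Km v)
    w0 wp wm wpp wmm y0 yp ym ypp ymm
    (hsa K0) (hid K0) hw0' (hsa Kp) (hid Kp) hyp' (hsa Km) (hid Km) hym'
    hl he hd0 hdmin hD0
    (by rw [hri]; exact hg0) (by rw [hri]; exact hgp) (by rw [hri]; exact hgm) (by rw [hri]; exact hgpp)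
    (by rw [hri]; exact hgmm) hYp hYm hY0 hp hm hpp hmm c1 c2 c3 c4
  have hsm : ∀ (r : ℝ) (v : (EuclideanSpace ℂ (Fin 3))), (@HSMul.hSMul ℝ (EuclideanSpace ℂ (Fin 3)) (EuclideanSpace ℂ (Fin 3)) (@instHSMul ℝ (EuclideanSpace ℂ (Fin 3)) ipr.toModule.toSMul) r v) = (r : ℂ) • v :=
    fun r v => rfl
  have hx : xdotV (E := (EuclideanSpace ℂ (Fin 3))) l (fun v => transversalProj K0 v) (fun v => transversalProj Kp v)
      (fun v => transversalProj Km v) w0 wp wm wpp wmm y0 yp ym = xdotC l K0 Kp Km w0 wp wm wpp wmm y0 yp ym := by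
    simp only [xdotV, xdotC, dW0, dWp, dWm, bV, dW0C, dWpC, dWmC, bC, hri, hsm]
  simpa only [hri, hx] using h

/-- **Norm equivalence of the cross term on the fibre**: `2|e·Re⟪w₀, b⟫| ≤ eℓ√2 (‖w₀‖² + ‖w₊‖² + ‖w₋‖²)`. -/
theorem threeModeC3_equiv (l e : ℝ) (K0 : Fin 3 → ℤ) (w0 wp wm : (EuclideanSpace ℂ (Fin 3))) (hl : 0 ≤ l) (he : 0 ≤ e) :
    2 * |e * (⟪w0, bC l K0 wp wm⟫_ℂ).re| ≤ e * l * Real.sqrt 2 * (‖w0‖ ^ 2 + ‖wp‖ ^ 2 + ‖wm‖ ^ 2) := by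
  letI ipr : InnerProductSpace ℝ (EuclideanSpace ℂ (Fin 3)) := InnerProductSpace.rclikeToReal ℂ (EuclideanSpace ℂ (Fin 3))
  have hri : ∀ x z : (EuclideanSpace ℂ (Fin 3)), ⟪x, z⟫_ℝ = (⟪x, z⟫_ℂ).re := fun x z => real_inner_eq_re_inner ℂ x z
  have hsa : ∀ (x z : (EuclideanSpace ℂ (Fin 3))), ⟪(fun v => transversalProj K0 v) x, z⟫_ℝ = ⟪x, (fun v => transversalProj K0 v) z⟫_ℝ := by
    intro x z; simp only [hri, inner_transversalProj_comm]
  have hsm : ∀ (r : ℝ) (v : (EuclideanSpace ℂ (Fin 3))), (@HSMul.hSMul ℝ (EuclideanSpace ℂ (Fin 3)) (EuclideanSpace ℂ (Fin 3)) (@instHSMul ℝ (EuclideanSpace ℂ (Fin 3)) ipr.toModule.toSMul) r v) = (r : ℂ) • v :=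
    fun r v => rfl
  have h := threeModeV_equiv (E := (EuclideanSpace ℂ (Fin 3))) l e (fun v => transversalProj K0 v) w0 wp wm hsa (transversalProj_idem K0) hl he
  have hb : bV (E := (EuclideanSpace ℂ (Fin 3))) l (fun v => transversalProj K0 v) wp wm = bC l K0 wp wm := by
    simp only [bV, bC, hsm]
  simpa only [hri, hb] using h

/-- **Ramp pairing on the fibre**: `|Re⟪w₀, P₀(w₊ − w₋)⟫| ≤ ‖w₀‖(‖w₊‖ + ‖w₋‖)`. -/
theorem rampC3_pairing_le (K0 : Fin 3 → ℤ) (w0 wp wm : (EuclideanSpace ℂ (Fin 3))) :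
    |(⟪w0, transversalProj K0 (wp - wm)⟫_ℂ).re| ≤ ‖w0‖ * (‖wp‖ + ‖wm‖) := by
  letI ipr : InnerProductSpace ℝ (EuclideanSpace ℂ (Fin 3)) := InnerProductSpace.rclikeToReal ℂ (EuclideanSpace ℂ (Fin 3))
  have hri : ∀ x z : (EuclideanSpace ℂ (Fin 3)), ⟪x, z⟫_ℝ = (⟪x, z⟫_ℂ).re := fun x z => real_inner_eq_re_inner ℂ x z
  have hsa : ∀ (x z : (EuclideanSpace ℂ (Fin 3))), ⟪(fun v => transversalProj K0 v) x, z⟫_ℝ = ⟪x, (fun v => transversalProj K0 v) z⟫_ℝ := by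
    intro x z; simp only [hri, inner_transversalProj_comm]
  have h := rampV_pairing_le (E := (EuclideanSpace ℂ (Fin 3))) (fun v => transversalProj K0 v) w0 wp wm hsa (transversalProj_idem K0)
  simpa only [hri] using h

/-! ## §5 Coercivity hypotheses discharged for the tree's generator (the `d_j` of the window) -/

/-- With `y_j := modalAdjGen 𝔸 K_j w_j` and `NearIso 𝔸 lo hi`, the coercivity hypotheses `hg_j` of `threeModeC3_form_le` hold with
`d_j := 4π²·lo·|K_j|²` for transversal `w_j` — packaged for the three chain modes and the two outer neighbours. -/
theorem coercivity_modalAdjGen {𝔸 : Visc4 (Fin 3)} {lo hi : ℝ} (h𝔸 : NearIso 𝔸 lo hi)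
    (K : Fin 3 → ℤ) (w : (EuclideanSpace ℂ (Fin 3))) (hw : kdot K w = 0) :
    (4 * Real.pi ^ 2 * lo * Literature.Analysis.FunctionSpaces.Torus.freqNormSq K) * ‖w‖ ^ 2
      ≤ (⟪modalAdjGen 𝔸 K w, w⟫_ℂ).re := by
  have := re_inner_modalAdjGen_ge h𝔸 K hw
  linarith [this]


/-! ## §F5 The UPPER norm bound of the modal generator on transversal vectors — discharges `Dmax`, `D0`
`‖modalAdjGen 𝔸 K w‖ ≤ 4π²·(hi + β/2)·|K|²·‖w‖` for `kdot K w = 0`, `NearIso 𝔸 lo hi` (`0 ≤ lo`, `0 ≤ hi`), `OddSmall 𝔸 β` (`0 ≤ β`):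
symmetric part by the Cauchy–Schwarz inequality of the (positive, by `0 ≤ lo`) transverse symbol form, odd part by `OddSmall`,
complex ↔ real parts by the bilinear version of `re_inner_symbT_eq`. -/

open Literature.Analysis.FunctionSpaces.Torus (freqNormSq freqNormSq_nonneg) in
/-- Additivity of the bilinear symbol in its first vector argument. -/
theorem bsymb_add_left (𝔸 : Visc4 (Fin 3)) (k p p' q : Fin 3 → ℝ) :
    bsymb 𝔸 k (p + p') q = bsymb 𝔸 k p q + bsymb 𝔸 k p' q := by
  simp only [bsymb, Pi.add_apply, add_mul, mul_add, Finset.sum_add_distrib]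

/-- Additivity of the bilinear symbol in its second vector argument. -/
theorem bsymb_add_right (𝔸 : Visc4 (Fin 3)) (k p q q' : Fin 3 → ℝ) :
    bsymb 𝔸 k p (q + q') = bsymb 𝔸 k p q + bsymb 𝔸 k p q' := by
  simp only [bsymb, Pi.add_apply, add_mul, mul_add, Finset.sum_add_distrib]

/-- Transversality is linear. -/
theorem transversal_add_smul (k p q : Fin 3 → ℝ) (t : ℝ) (hp : ∑ i, p i * k i = 0) (hq : ∑ i, q i * k i = 0) :
    ∑ i, (p + t • q) i * k i = 0 := by
  have : ∑ i, (p + t • q) i * k i = ∑ i, p i * k i + t * ∑ i, q i * k i := by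
    rw [Finset.mul_sum, ← Finset.sum_add_distrib]
    refine Finset.sum_congr rfl fun i _ => ?_
    simp only [Pi.add_apply, Pi.smul_apply, smul_eq_mul]; ring
  rw [this, hp, hq, mul_zero, add_zero]

/-- **Cauchy–Schwarz for the symmetrised transverse symbol** (positive by `0 ≤ lo`):
`(β(p,q) + β(q,p))² ≤ 4·(hi|k|²|p|²)·(hi|k|²|q|²)` for transversal `p, q`. -/
theorem bsymb_symm_sq_le {𝔸 : Visc4 (Fin 3)} {lo hi : ℝ} (h𝔸 : NearIso 𝔸 lo hi) (hlo : 0 ≤ lo)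
    (k p q : Fin 3 → ℝ) (hp : ∑ i, p i * k i = 0) (hq : ∑ i, q i * k i = 0) :
    (bsymb 𝔸 k p q + bsymb 𝔸 k q p) ^ 2
      ≤ 4 * (hi * ((∑ a, k a ^ 2) * ∑ i, p i ^ 2)) * (hi * ((∑ a, k a ^ 2) * ∑ i, q i ^ 2)) := by
  have hQ : ∀ t : ℝ, 0 ≤ symb 𝔸 k q * (t * t) + (bsymb 𝔸 k p q + bsymb 𝔸 k q p) * t + symb 𝔸 k p := by
    intro t
    have htr := transversal_add_smul k p q t hp hq
    have h0 : 0 ≤ symb 𝔸 k (p + t • q) :=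
      le_trans (mul_nonneg hlo (by positivity)) (h𝔸 k (p + t • q) htr).1
    have hexp : symb 𝔸 k (p + t • q)
        = symb 𝔸 k q * (t * t) + (bsymb 𝔸 k p q + bsymb 𝔸 k q p) * t + symb 𝔸 k p := by
      rw [symb_eq_bsymb, bsymb_add_left, bsymb_add_right, bsymb_add_right, bsymb_smul_left, bsymb_smul_right,
        bsymb_smul_right, bsymb_smul_left, ← symb_eq_bsymb, ← symb_eq_bsymb]
      ring
    linarith [h0, hexp]
  have hd := discrim_le_zero hQ
  rw [discrim] at hd
  have hQp : symb 𝔸 k p ≤ hi * ((∑ a, k a ^ 2) * ∑ i, p i ^ 2) := (h𝔸 k p hp).2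
  have hQq : symb 𝔸 k q ≤ hi * ((∑ a, k a ^ 2) * ∑ i, q i ^ 2) := (h𝔸 k q hq).2
  have hQp0 : 0 ≤ symb 𝔸 k p := le_trans (mul_nonneg hlo (by positivity)) (h𝔸 k p hp).1
  have hQq0 : 0 ≤ symb 𝔸 k q := le_trans (mul_nonneg hlo (by positivity)) (h𝔸 k q hq).1
  nlinarith [mul_le_mul hQq hQp hQp0 (le_trans hQq0 hQq)]

/-- `|x| ≤ B` from `x² ≤ B²` and `0 ≤ B`. -/
theorem abs_le_of_sq_le_sq'' {x B : ℝ} (h : x ^ 2 ≤ B ^ 2) (hB : 0 ≤ B) : |x| ≤ B := by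
  have := Real.sqrt_le_sqrt h
  rwa [Real.sqrt_sq_eq_abs, Real.sqrt_sq hB] at this

/-- **Bilinear bound of the transverse symbol**: `|β_𝔸(k; p, q)| ≤ (hi + β/2)·|k|²·|p|·|q|` for transversal `p, q`
under `NearIso 𝔸 lo hi` (`0 ≤ lo ≤`, `0 ≤ hi`) and `OddSmall 𝔸 β` (`0 ≤ β`). -/
theorem abs_bsymb_le {𝔸 : Visc4 (Fin 3)} {lo hi β : ℝ} (h𝔸 : NearIso 𝔸 lo hi) (hlo : 0 ≤ lo) (hhi : 0 ≤ hi)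
    (hodd : OddSmall 𝔸 β) (hβ : 0 ≤ β) (k p q : Fin 3 → ℝ) (hp : ∑ i, p i * k i = 0) (hq : ∑ i, q i * k i = 0) :
    |bsymb 𝔸 k p q| ≤ (hi + β / 2) * (∑ a, k a ^ 2) * (Real.sqrt (∑ i, p i ^ 2) * Real.sqrt (∑ i, q i ^ 2)) := by
  have hK2 : 0 ≤ ∑ a, k a ^ 2 := by positivity
  have hP2 : 0 ≤ ∑ i, p i ^ 2 := by positivity
  have hQ2 : 0 ≤ ∑ i, q i ^ 2 := by positivity
  have hSP := Real.sq_sqrt hP2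
  have hSQ := Real.sq_sqrt hQ2
  have hsP := Real.sqrt_nonneg (∑ i, p i ^ 2)
  have hsQ := Real.sqrt_nonneg (∑ i, q i ^ 2)
  -- symmetric part
  have hs : |bsymb 𝔸 k p q + bsymb 𝔸 k q p| ≤ 2 * hi * (∑ a, k a ^ 2) * (Real.sqrt (∑ i, p i ^ 2) * Real.sqrt (∑ i, q i ^ 2)) := by
    have h := bsymb_symm_sq_le h𝔸 hlo k p q hp hq
    refine abs_le_of_sq_le_sq'' ?_ (by positivity)
    calc (bsymb 𝔸 k p q + bsymb 𝔸 k q p) ^ 2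
        ≤ 4 * (hi * ((∑ a, k a ^ 2) * ∑ i, p i ^ 2)) * (hi * ((∑ a, k a ^ 2) * ∑ i, q i ^ 2)) := h
      _ = (2 * hi * (∑ a, k a ^ 2) * (Real.sqrt (∑ i, p i ^ 2) * Real.sqrt (∑ i, q i ^ 2))) ^ 2 := by
          rw [show (2 * hi * (∑ a, k a ^ 2) * (Real.sqrt (∑ i, p i ^ 2) * Real.sqrt (∑ i, q i ^ 2))) ^ 2
              = 4 * hi ^ 2 * (∑ a, k a ^ 2) ^ 2 * (Real.sqrt (∑ i, p i ^ 2) ^ 2 * Real.sqrt (∑ i, q i ^ 2) ^ 2) by ring,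
            hSP, hSQ]
          ring
  -- odd part
  have ho : |bsymb 𝔸 k p q - bsymb 𝔸 k q p| ≤ β * (∑ a, k a ^ 2) * (Real.sqrt (∑ i, p i ^ 2) * Real.sqrt (∑ i, q i ^ 2)) := by
    have h := hodd k p q hp hq
    refine abs_le_of_sq_le_sq'' ?_ (by positivity)
    calc (bsymb 𝔸 k p q - bsymb 𝔸 k q p) ^ 2
        ≤ β ^ 2 * ((∑ a, k a ^ 2) ^ 2 * ((∑ i, p i ^ 2) * (∑ i, q i ^ 2))) := h
      _ = (β * (∑ a, k a ^ 2) * (Real.sqrt (∑ i, p i ^ 2) * Real.sqrt (∑ i, q i ^ 2))) ^ 2 := by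
          rw [show (β * (∑ a, k a ^ 2) * (Real.sqrt (∑ i, p i ^ 2) * Real.sqrt (∑ i, q i ^ 2))) ^ 2
              = β ^ 2 * (∑ a, k a ^ 2) ^ 2 * (Real.sqrt (∑ i, p i ^ 2) ^ 2 * Real.sqrt (∑ i, q i ^ 2) ^ 2) by ring,
            hSP, hSQ]
          ring
  have hsplit : bsymb 𝔸 k p q = ((bsymb 𝔸 k p q + bsymb 𝔸 k q p) + (bsymb 𝔸 k p q - bsymb 𝔸 k q p)) / 2 := by ring
  rw [hsplit, abs_div, abs_two]
  have := abs_add_le (bsymb 𝔸 k p q + bsymb 𝔸 k q p) (bsymb 𝔸 k p q - bsymb 𝔸 k q p)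
  have hR : 0 ≤ (∑ a, k a ^ 2) * (Real.sqrt (∑ i, p i ^ 2) * Real.sqrt (∑ i, q i ^ 2)) := by positivity
  nlinarith [hs, ho, this, hR]

/-- `Re((r v) ū) = r (Re u Re v + Im u Im v)` for real `r` (local copy of the tree's private helper). -/
theorem re_ofReal_mul_mul_conj' (r : ℝ) (u v : ℂ) :
    ((r : ℂ) * v * (starRingEnd ℂ) u).re = r * (u.re * v.re + u.im * v.im) := by
  simp [Complex.mul_re, Complex.mul_im]
  ring

/-- **Bilinear version of `re_inner_symbT_eq`**: `Re⟪u, T_𝔸(k) w⟫ = β_𝔸(k; Re w, Re u) + β_𝔸(k; Im w, Im u)`. -/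
theorem re_inner_symbT_bilin (𝔸 : Visc4 (Fin 3)) (k : Fin 3 → ℤ) (u w : (EuclideanSpace ℂ (Fin 3))) :
    (⟪u, symbT 𝔸 k w⟫_ℂ).re
      = bsymb 𝔸 (fun a => (k a : ℝ)) (fun i => (w i).re) (fun j => (u j).re)
        + bsymb 𝔸 (fun a => (k a : ℝ)) (fun i => (w i).im) (fun j => (u j).im) := by
  have h1 : (⟪u, symbT 𝔸 k w⟫_ℂ).re =
      ∑ j, ∑ i, ∑ a, ∑ b, (𝔸 i a j b * (k a : ℝ) * (k b : ℝ)) * ((u j).re * (w i).re + (u j).im * (w i).im) := by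
    rw [PiLp.inner_apply, Complex.re_sum]
    refine Finset.sum_congr rfl fun j _ => ?_
    rw [RCLike.inner_apply, symbT_apply, Finset.sum_mul, Complex.re_sum]
    refine Finset.sum_congr rfl fun i _ => ?_
    rw [Finset.sum_mul, Complex.re_sum]
    refine Finset.sum_congr rfl fun a _ => ?_
    rw [Finset.sum_mul, Complex.re_sum]
    refine Finset.sum_congr rfl fun b _ => ?_
    exact re_ofReal_mul_mul_conj' _ _ _
  rw [h1, Finset.sum_comm]
  simp only [bsymb, ← Finset.sum_add_distrib]
  refine Finset.sum_congr rfl fun i _ => ?_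
  rw [Finset.sum_comm]
  refine Finset.sum_congr rfl fun a _ => Finset.sum_congr rfl fun j _ =>
    Finset.sum_congr rfl fun b _ => ?_
  ring

/-- Transversality of a complex vector passes to its real and imaginary parts (local copy of the tree's private helper). -/
theorem re_im_transversal {k : Fin 3 → ℤ} {z : (EuclideanSpace ℂ (Fin 3))} (hz : kdot k z = 0) :
    ∑ i, (z i).re * (k i : ℝ) = 0 ∧ ∑ i, (z i).im * (k i : ℝ) = 0 := by
  rw [kdot_apply] at hz
  have hre := congrArg Complex.re hz
  have him := congrArg Complex.im hz
  rw [Complex.re_sum, Complex.zero_re] at hre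
  rw [Complex.im_sum, Complex.zero_im] at him
  constructor
  · rw [← hre]
    refine Finset.sum_congr rfl fun i _ => ?_
    rw [← Complex.ofReal_intCast, Complex.re_ofReal_mul, mul_comm]
  · rw [← him]
    refine Finset.sum_congr rfl fun i _ => ?_
    rw [← Complex.ofReal_intCast, Complex.im_ofReal_mul, mul_comm]

/-- `‖z‖² = Σ (Re zᵢ)² + Σ (Im zᵢ)²` on `ℂ³`. -/
theorem norm_sq_re_im (z : (EuclideanSpace ℂ (Fin 3))) : ‖z‖ ^ 2 = ∑ i, (z i).re ^ 2 + ∑ i, (z i).im ^ 2 := by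
  rw [EuclideanSpace.norm_sq_eq, ← Finset.sum_add_distrib]
  refine Finset.sum_congr rfl fun i _ => ?_
  rw [Complex.sq_norm, Complex.normSq_apply]
  ring

/-- Cauchy–Schwarz in `ℝ²` with square roots: `√a√c + √b√d ≤ √(a+b)·√(c+d)` for `a b c d ≥ 0`. -/
theorem sqrt_mul_add_sqrt_mul_le {a b c d : ℝ} (ha : 0 ≤ a) (hb : 0 ≤ b) (hc : 0 ≤ c) (hd : 0 ≤ d) :
    Real.sqrt a * Real.sqrt c + Real.sqrt b * Real.sqrt d ≤ Real.sqrt (a + b) * Real.sqrt (c + d) := by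
  set x := Real.sqrt a; set y := Real.sqrt b; set z := Real.sqrt c; set t := Real.sqrt d
  have hx : x ^ 2 = a := Real.sq_sqrt ha
  have hy : y ^ 2 = b := Real.sq_sqrt hb
  have hz : z ^ 2 = c := Real.sq_sqrt hc
  have ht : t ^ 2 = d := Real.sq_sqrt hd
  have h0 : 0 ≤ x * z + y * t := by positivity
  have hsq : (x * z + y * t) ^ 2 ≤ (a + b) * (c + d) := by
    rw [← hx, ← hy, ← hz, ← ht]; nlinarith [sq_nonneg (x * t - y * z)]
  have := Real.sqrt_le_sqrt hsq
  rwa [Real.sqrt_sq h0, Real.sqrt_mul (by positivity)] at this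

open Literature.Analysis.FunctionSpaces.Torus (freqNormSq) in
/-- **`Re⟪u, T_𝔸(K) w⟫ ≤ (hi + β/2)·|K|²·‖w‖·‖u‖` for transversal `u, w`** (the bilinear window bound). -/
theorem re_inner_symbT_le {𝔸 : Visc4 (Fin 3)} {lo hi β : ℝ} (h𝔸 : NearIso 𝔸 lo hi) (hlo : 0 ≤ lo) (hhi : 0 ≤ hi)
    (hodd : OddSmall 𝔸 β) (hβ : 0 ≤ β) (K : Fin 3 → ℤ) {u w : (EuclideanSpace ℂ (Fin 3))} (hu : kdot K u = 0) (hw : kdot K w = 0) :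
    (⟪u, symbT 𝔸 K w⟫_ℂ).re ≤ (hi + β / 2) * freqNormSq K * (‖w‖ * ‖u‖) := by
  obtain ⟨hur, hui⟩ := re_im_transversal hu
  obtain ⟨hwr, hwi⟩ := re_im_transversal hw
  have hK : (∑ a, ((fun a => (K a : ℝ)) a) ^ 2) = freqNormSq K := by simp [freqNormSq]
  have h1 := abs_bsymb_le h𝔸 hlo hhi hodd hβ (fun a => (K a : ℝ)) (fun i => (w i).re) (fun j => (u j).re) hwr hur
  have h2 := abs_bsymb_le h𝔸 hlo hhi hodd hβ (fun a => (K a : ℝ)) (fun i => (w i).im) (fun j => (u j).im) hwi hui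
  rw [hK] at h1 h2
  have hcs := sqrt_mul_add_sqrt_mul_le (a := ∑ i, (w i).re ^ 2) (b := ∑ i, (w i).im ^ 2)
    (c := ∑ i, (u i).re ^ 2) (d := ∑ i, (u i).im ^ 2) (by positivity) (by positivity) (by positivity) (by positivity)
  have hwn : Real.sqrt (∑ i, (w i).re ^ 2 + ∑ i, (w i).im ^ 2) = ‖w‖ := by
    rw [← norm_sq_re_im, Real.sqrt_sq (norm_nonneg _)]
  have hun : Real.sqrt (∑ i, (u i).re ^ 2 + ∑ i, (u i).im ^ 2) = ‖u‖ := by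
    rw [← norm_sq_re_im, Real.sqrt_sq (norm_nonneg _)]
  rw [hwn, hun] at hcs
  rw [re_inner_symbT_bilin]
  have hc : 0 ≤ (hi + β / 2) * freqNormSq K := mul_nonneg (by linarith) (Literature.Analysis.FunctionSpaces.Torus.freqNormSq_nonneg K)
  calc bsymb 𝔸 (fun a => (K a : ℝ)) (fun i => (w i).re) (fun j => (u j).re)
        + bsymb 𝔸 (fun a => (K a : ℝ)) (fun i => (w i).im) (fun j => (u j).im)
      ≤ (hi + β / 2) * freqNormSq K * (Real.sqrt (∑ i, (w i).re ^ 2) * Real.sqrt (∑ i, (u i).re ^ 2))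
        + (hi + β / 2) * freqNormSq K * (Real.sqrt (∑ i, (w i).im ^ 2) * Real.sqrt (∑ i, (u i).im ^ 2)) :=
        add_le_add (le_trans (le_abs_self _) h1) (le_trans (le_abs_self _) h2)
    _ = (hi + β / 2) * freqNormSq K * (Real.sqrt (∑ i, (w i).re ^ 2) * Real.sqrt (∑ i, (u i).re ^ 2)
        + Real.sqrt (∑ i, (w i).im ^ 2) * Real.sqrt (∑ i, (u i).im ^ 2)) := by ring
    _ ≤ (hi + β / 2) * freqNormSq K * (‖w‖ * ‖u‖) := mul_le_mul_of_nonneg_left hcs hc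

open Literature.Analysis.FunctionSpaces.Torus (freqNormSq) in
/-- **UPPER NORM BOUND of the modal generator on transversal vectors** — the `Dmax`/`D0` hypotheses of `threeModeC3_form_le`
for `y_j := modalAdjGen 𝔸 K_j w_j`: `‖L_K w‖ ≤ 4π²·(hi + β/2)·|K|²·‖w‖` (`kdot K w = 0`, `NearIso 𝔸 lo hi` with `0 ≤ lo`, `0 ≤ hi`,
`OddSmall 𝔸 β` with `0 ≤ β`). -/
theorem norm_modalAdjGen_le {𝔸 : Visc4 (Fin 3)} {lo hi β : ℝ} (h𝔸 : NearIso 𝔸 lo hi) (hlo : 0 ≤ lo) (hhi : 0 ≤ hi)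
    (hodd : OddSmall 𝔸 β) (hβ : 0 ≤ β) (K : Fin 3 → ℤ) (w : (EuclideanSpace ℂ (Fin 3))) (hw : kdot K w = 0) :
    ‖modalAdjGen 𝔸 K w‖ ≤ 4 * Real.pi ^ 2 * (hi + β / 2) * freqNormSq K * ‖w‖ := by
  by_cases hK : K = 0
  · subst hK
    simp [modalAdjGen_apply, freqNormSq]
  have hu : kdot K (modalAdjGen 𝔸 K w) = 0 := kdot_modalAdjGen 𝔸 hK w
  have e1 : (⟪modalAdjGen 𝔸 K w, modalAdjGen 𝔸 K w⟫_ℂ).re = ‖modalAdjGen 𝔸 K w‖ ^ 2 := by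
    have := inner_self_eq_norm_sq (𝕜 := ℂ) (modalAdjGen 𝔸 K w)
    simpa using this
  have e2 : (⟪modalAdjGen 𝔸 K w, modalAdjGen 𝔸 K w⟫_ℂ).re
      = 4 * Real.pi ^ 2 * (⟪modalAdjGen 𝔸 K w, symbT 𝔸 K w⟫_ℂ).re := by
    have : ⟪modalAdjGen 𝔸 K w, modalAdjGen 𝔸 K w⟫_ℂ
        = ⟪modalAdjGen 𝔸 K w, ((4 * Real.pi ^ 2 : ℝ) : ℂ) • transversalProj K (symbT 𝔸 K w)⟫_ℂ := rfl
    rw [this, inner_smul_right, ← inner_transversalProj_comm, transversalProj_eq_self_of_kdot K hu, Complex.re_ofReal_mul]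
  have h3 := re_inner_symbT_le h𝔸 hlo hhi hodd hβ K hu hw
  have hsq : ‖modalAdjGen 𝔸 K w‖ ^ 2 ≤ (4 * Real.pi ^ 2 * (hi + β / 2) * freqNormSq K * ‖w‖) * ‖modalAdjGen 𝔸 K w‖ := by
    rw [← e1, e2]
    have hpi : 0 ≤ 4 * Real.pi ^ 2 := by positivity
    nlinarith [mul_le_mul_of_nonneg_left h3 hpi]
  have hR : 0 ≤ 4 * Real.pi ^ 2 * (hi + β / 2) * freqNormSq K * ‖w‖ := by
    have := Literature.Analysis.FunctionSpaces.Torus.freqNormSq_nonneg K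
    have : 0 ≤ hi + β / 2 := by linarith
    positivity
  by_cases h0 : ‖modalAdjGen 𝔸 K w‖ = 0
  · rw [h0]; exact hR
  · have hpos : 0 < ‖modalAdjGen 𝔸 K w‖ := lt_of_le_of_ne (norm_nonneg _) (Ne.symm h0)
    rw [pow_two] at hsq
    exact le_of_mul_le_mul_right hsq hpos

end Fibre

end Summit.AnomalousDissipation.AnomalousDissipation.Theorems.SolenoidalFractalHomogenisation.LagrangianStep.ThreeMode
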